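import Summits.CriticalPhenomena.PercolationContinuityZ3.Theorems.PercNearOneGluingNoHeavyQuantIndepBlobOddSizeRow
import HarnessLib

/-!
# QUANT lane R8, FAR for independent blobs (IX): the odd-size row survives ANY NUMBER of extra blobs of arbitrary gates —
# Conjecture DIB* in the case 'floor `≥ 1/2`, heavy total `≥ 2j+1`', light credit not needed

builds on p205010 (kernel theorem, internal audit signed; external expert review pending)

Support file (`--supports stmt-CriticalPhenomena-4575`), QUANT lane lead (gen 15); memo
`run/shared/lean/prim/quant/prim-quant-lead-g15/LEAD-NOTES-G15.md` N27–N29; architecture of record README V185.  Theorems only, no definitions, no sorries,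
standard axioms.  Companion of `…QuantIndepBlobOddSizeRow` (one extra blob) and `…QuantIndepBlobDiscountLow` (every floor `≤ 1/2`).

* `Quant.IndepBlob.sizeRow_with_extra_blobs` — blobs on a finite type with gates in `[0,1]` and INTEGER sizes; a set `E` of EXTRA blobs (arbitrary gates — in DIB*
  these are the light ones, below the floor); a floor `y₀ ∉ E` with `1/2 ≤ p y₀ ≤ p k` for every `k ∉ E`; a level `j` with `2j + 1 + Σ_{k∈E} a k ≤ Σ_k a k` (the blobs
  OUTSIDE `E` total at least `2j+1`).  Then `p y₀ ≤ P(W ≥ j+1)`.  Proof: induction on `#E`, conditioning on one extra blob at a time (`tail_split`); both branches dominate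
  the statement for the remaining blobs; the base case is the odd-size row `tail_ge_gate_of_two_mul_le_size_succ`.
CONSEQUENCE FOR T-DIB (quant README V185/V190): with `dibStar_of_le_half` (floor `≤ 1/2`, all cases) and this file (floor `≥ 1/2`, heavy total `≥ 2j+1`, any light part),
Conjecture DIB* is KERNEL except in the single corner 'floor `> 1/2` AND heavy total `≤ 2j`' (where the discounted light credit is genuinely load-bearing; exact-clean,
relative slack `≥ 0.25` off giants in the lead's census, Cantelli certifies ≈ 96 % of it).  [this work]
-/

namespace Summit.CriticalPhenomena.PercolationContinuityZ3.Theorems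

namespace Quant

namespace IndepBlob

open Finset

universe u

/-- **Odd-size row with any number of extra blobs.**  For every `n`, every finite type of blobs with gates `0 ≤ p k ≤ 1` and integer sizes, every set `E` of
`n` extra blobs (arbitrary gates), every floor `y₀ ∉ E` with `1/2 ≤ p y₀ ≤ p k` for all `k ∉ E`, and every level `j` with `2j + 1 + Σ_{k∈E} a k ≤ Σ_k a k`:
`p y₀ ≤ Σ_{s : j+1 ≤ a(s)} w(s)` (`= P(W ≥ j+1)`). [this work] -/
theorem sizeRow_with_extra_blobs_aux : ∀ (n : ℕ) {κ : Type u} [Fintype κ] [DecidableEq κ] (p : κ → ℝ) (a : κ → ℕ),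
    (∀ k, 0 ≤ p k) → (∀ k, p k ≤ 1) → ∀ (E : Finset κ), E.card = n → ∀ (y₀ : κ), y₀ ∉ E → (∀ k, k ∉ E → p y₀ ≤ p k) → 1 / 2 ≤ p y₀ →
    ∀ (j : ℕ), 2 * j + 1 + ∑ k ∈ E, a k ≤ ∑ k, a k →
    p y₀ ≤ ∑ s ∈ (Finset.univ : Finset (Finset κ)).filter (fun s => j + 1 ≤ ∑ k ∈ s, a k), (∏ k, if k ∈ s then p k else 1 - p k) := by
  intro n
  induction n with
  | zero =>
    intro κ _ _ p a hp0 hp1 E hE y₀ hy₀E hy₀ hhalf j hsize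
    have hE0 : E = ∅ := Finset.card_eq_zero.1 hE
    subst hE0
    refine tail_ge_gate_of_two_mul_le_size_succ p a hp0 hp1 y₀ (fun k => hy₀ k (Finset.notMem_empty k)) hhalf (j + 1) ?_
    rw [Finset.sum_empty] at hsize
    omega
  | succ n IH =>
    intro κ _ _ p a hp0 hp1 E hE y₀ hy₀E hy₀ hhalf j hsize
    -- pick an extra blob `x₀ ∈ E` and condition on it
    obtain ⟨x₀, hx₀⟩ : E.Nonempty := Finset.card_pos.1 (by omega)
    have hne : y₀ ≠ x₀ := fun h => hy₀E (h ▸ hx₀)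
    set ι := {k : κ // k ≠ x₀} with hι
    have hw0' : ∀ W : Finset ι, 0 ≤ (∏ i : ι, if i ∈ W then p i else 1 - p i) :=
      bernoulliWeight_nonneg (fun i => hp0 i) (fun i => hp1 i)
    set A : ℝ := ∑ W ∈ (Finset.univ : Finset (Finset ι)).filter (fun W : Finset ι => j + 1 ≤ a x₀ + ∑ i ∈ W, a (i : κ)),
        (∏ i : ι, if i ∈ W then p i else 1 - p i) with hA
    set U : ℝ := ∑ W ∈ (Finset.univ : Finset (Finset ι)).filter (fun W : Finset ι => j + 1 ≤ ∑ i ∈ W, a (i : κ)),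
        (∏ i : ι, if i ∈ W then p i else 1 - p i) with hU
    rw [tail_split p a x₀ (j + 1)]
    show p y₀ ≤ p x₀ * A + (1 - p x₀) * U
    have hAU : U ≤ A := by
      refine Finset.sum_le_sum_of_subset_of_nonneg (fun W hW => ?_) fun W _ _ => hw0' W
      rw [Finset.mem_filter] at hW ⊢
      exact ⟨hW.1, by omega⟩
    -- the remaining extra blobs, as a finset of the subtype
    set E' : Finset ι := (E.erase x₀).subtype (fun k => k ≠ x₀) with hE'
    have hE'card : E'.card = n := by
      rw [hE', Finset.card_subtype]
      have hf : (E.erase x₀).filter (fun k => k ≠ x₀) = E.erase x₀ :=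
        Finset.filter_true_of_mem fun k hk => (Finset.mem_erase.1 hk).1
      rw [hf, Finset.card_erase_of_mem hx₀, hE]
      omega
    have hmemE' : ∀ i : ι, i ∈ E' ↔ (i : κ) ∈ E := by
      intro i
      rw [hE', Finset.mem_subtype, Finset.mem_erase]
      exact ⟨fun h => h.2, fun h => ⟨i.2, h⟩⟩
    have hy₀E' : (⟨y₀, hne⟩ : ι) ∉ E' := fun h => hy₀E ((hmemE' _).1 h)
    have hy₀' : ∀ i : ι, i ∉ E' → p y₀ ≤ p (i : κ) := fun i hi => hy₀ i (fun h => hi ((hmemE' i).2 h))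
    -- sizes: `Σ_E a = a x₀ + Σ_{E'} a` and `Σ_κ a = a x₀ + Σ_ι a`
    have hsumE : ∑ k ∈ E, a k = a x₀ + ∑ i ∈ E', a (i : κ) := by
      rw [← Finset.add_sum_erase E _ hx₀, hE', Finset.sum_subtype_eq_sum_filter]
      have hf : (E.erase x₀).filter (fun k => k ≠ x₀) = E.erase x₀ :=
        Finset.filter_true_of_mem fun k hk => (Finset.mem_erase.1 hk).1
      rw [hf]
    have hsplit : ∑ k, a k = a x₀ + ∑ i : ι, a (i : κ) := by
      rw [← Finset.add_sum_erase Finset.univ _ (Finset.mem_univ x₀),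
        Finset.sum_subtype (Finset.univ.erase x₀) (p := fun k => k ≠ x₀) (fun k => by simp)]
    have hsize' : 2 * j + 1 + ∑ i ∈ E', a (i : κ) ≤ ∑ i : ι, a (i : κ) := by
      rw [hsumE, hsplit] at hsize
      omega
    have hrow := IH (fun i : ι => p i) (fun i : ι => a (i : κ)) (fun i => hp0 i) (fun i => hp1 i) E' hE'card ⟨y₀, hne⟩ hy₀E'
      hy₀' hhalf j hsize'
    -- `hrow : p y₀ ≤ U`
    have hpx0 : 0 ≤ p x₀ := hp0 x₀
    have hpx1 : p x₀ ≤ 1 := hp1 x₀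
    calc p y₀ ≤ U := hrow
      _ = p x₀ * U + (1 - p x₀) * U := by ring
      _ ≤ p x₀ * A + (1 - p x₀) * U := by nlinarith

/-- **Odd-size row with any number of extra blobs (DIB*, case 'floor `≥ 1/2`, heavy total `≥ 2j+1`').**  Blobs with gates `0 ≤ p k ≤ 1` and integer sizes; extra blobs
`E` of arbitrary gates; a floor `y₀ ∉ E` with `1/2 ≤ p y₀ ≤ p k` for every `k ∉ E`; a level `j` with `2j + 1 + Σ_{k∈E} a k ≤ Σ_k a k`.  Then `p y₀ ≤ P(W ≥ j+1)`:
the light blobs of DIB* may be adjoined at no cost when the heavy ones already total `2j+1`. [this work] -/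
theorem sizeRow_with_extra_blobs {κ : Type u} [Fintype κ] [DecidableEq κ] (p : κ → ℝ) (a : κ → ℕ) (hp0 : ∀ k, 0 ≤ p k) (hp1 : ∀ k, p k ≤ 1)
    (E : Finset κ) (y₀ : κ) (hy₀E : y₀ ∉ E) (hy₀ : ∀ k, k ∉ E → p y₀ ≤ p k) (hhalf : 1 / 2 ≤ p y₀) (j : ℕ)
    (hsize : 2 * j + 1 + ∑ k ∈ E, a k ≤ ∑ k, a k) :
    p y₀ ≤ ∑ s ∈ (Finset.univ : Finset (Finset κ)).filter (fun s => j + 1 ≤ ∑ k ∈ s, a k), (∏ k, if k ∈ s then p k else 1 - p k) :=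
  sizeRow_with_extra_blobs_aux E.card p a hp0 hp1 E rfl y₀ hy₀E hy₀ hhalf j hsize

end IndepBlob

end Quant

end Summit.CriticalPhenomena.PercolationContinuityZ3.Theorems
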